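import Summits.ValiantsHypothesis.ValiantsHypothesis.Theses.BinomialElusive

/-!
# Route BinomialElusive — item `Assembly`

Item `stmt-ValiantsHypothesis-10469` (assembly of route `BinomialElusive`): pure bookkeeping.
`Assembly` is the implication
`BinomialCandidate → RazTransfer → PerNotVPToVH → ValiantsHypothesis`, where
* `BinomialCandidate` is the route thesis X (the explicit binomial curves are `(m-1, 2)`-elusive
  for all large `m`),
* `RazTransfer` is literally `X → ¬ IsVPFamily_ℂ (per_n)` (its hypothesis is the body of
  `BinomialCandidate`, verbatim), and
* `PerNotVPToVH` is `¬ IsVPFamily_ℂ (per_n) → ValiantsHypothesis`.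
So the item is modus ponens twice, exactly the route's deciding theorem
`closes : BinomialCandidate → RazTransfer → PerNotVPToVH → ValiantsHypothesis := fun hX hT hP => hP (hT hX)`.
No mathematics of the line lives here (it lives in PeelingLemma / BinomialCandidate /
BinomialMapsElusive / RazTransfer).
-/

namespace Summit.ValiantsHypothesis.Theorems

/-- **Assembly** (route BinomialElusive, item `stmt-ValiantsHypothesis-10469`):
`BinomialCandidate → RazTransfer → PerNotVPToVH → ValiantsHypothesis`.
Bookkeeping: `RazTransfer` applied to `BinomialCandidate` (its hypothesis is definitionally the
body of `BinomialCandidate`) gives `¬ IsVPFamily_ℂ (per_n)`, and `PerNotVPToVH` turns that into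
`ValiantsHypothesis`. [folklore] -/
theorem binomialElusive_assembly_proof :
    Summit.ValiantsHypothesis.ValiantsHypothesis.Theses.BinomialElusive.Assembly := by
  -- `Assembly` is now (crux-only ruling 2026-08-16, item stmt-ValiantsHypothesis-16827) the bare
  -- implication `BinomialCandidate → ValiantsHypothesis`; the route's deciding theorem `closes` has exactly
  -- that shape (both bridges `RazTransfer`/`PerNotVPToVH` are proved and used inside it).
  unfold Summit.ValiantsHypothesis.ValiantsHypothesis.Theses.BinomialElusive.Assembly
  intro hX
  exact Summit.ValiantsHypothesis.ValiantsHypothesis.Theses.BinomialElusive.closes hX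

end Summit.ValiantsHypothesis.Theorems
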